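import Literature.MathematicalPhysics.QuantumFieldTheory.Balaban1983to89.B12QtildeRemainder123
import Literature.MathematicalPhysics.QuantumFieldTheory.Balaban1983to89.B12Lineariz267

/-!
# `Balaban1983to89.B12LinearizationGenuineZd` — [Balaban1987RG1] p. 267 «there exists exactly one solution of this
equation»: THE LINEARIZING CHANGE OF VARIABLES `B′ = B − hD̃(B)` FOR [I]'S GENUINE `Q̃` of (2.4) on the `ℤᵈ`
corner-cube carrier, in the Banach space `ℓ^∞` of bounded bond fields — the tree's scheme `B12Lineariz267` /
`B13Contraction113` INSTANTIATED (its inputs (L), (H), (123) and line-analyticity being r09 g11's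
`B12LQLocalityBound267`, `B12B0RestrictionAverage267`, `B12QtildeRemainder123`)

HONEST FRAMING (cell `lit-balaban`, verbatim): statement-level skeleton of published theorems with citation tags;
proofs where landed; nothing here is a claim about the Yang–Mills mass gap.

CITATION HEADER.  T. Bałaban, *Renormalization group approach to lattice gauge field theories. I*, Commun. Math. Phys.
**109** (1987) 249–301 [Balaban1987RG1] (cell paper B12 = «[I]»; PDF held `paper:balaban1987-cmp109-rg-i-small-field`,
journal page = PDF page + 248): p. 267 [PDF 19]; the template [15] = T. Bałaban, *The variational problem and background
fields in renormalization group method for lattice gauge theories*, Commun. Math. Phys. **102** (1985) 277–309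
[Balaban1985Variational], Sect. C p. 286 (the contraction constant), as used BY NAME through the tree's
`B13Contraction113`/`B12Lineariz267`; [Balaban1985Averaging] Prop. 3 (122)–(123) p. 36 through
`B12QtildeRemainder123`.  Unit `lit-balaban-r09` gen 11 (reader/typer of CMP 109), SKELETON rows `B12.Def@267` (the
operator `h`, the change of variables, `D̃`) and `B12.Eq3.2` (`B̃′ = g_kCB − hD̃(g_kCB)`).

WHAT IS PRINTED (verbatim, p. 267).  *«At first we introduce an operator h. It transforms 𝐠-valued functions B
defined at bonds of the lattice T⁽ᵏ⁺¹⁾ into such functions defined at bonds of T⁽ᵏ⁾. The function hB is equal to 0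
everywhere, except the set {b₀(c) : c ∈ T⁽ᵏ⁺¹⁾}. … Furthermore, the operator h satisfies the identity LQ̃h = I on
T⁽ᵏ⁺¹⁾. … (hB)(b₀(c)) = h(c)B(c), where h(c) is a linear operator on the Lie algebra 𝐠, equal to an inverse of a
coefficient at the variable B′(b₀(c)) in (Q̃B′)(c), multiplied by L⁻¹. We are looking for an analytic, 𝐠-valued
function D̃(B), defined at bonds of T⁽ᵏ⁺¹⁾, and such that the transformation B′ = B − hD̃(B) linearizes the
function Q̃(B′). The function D̃(B) is determined by the equation LQ̃B′ + C̃(B′) = LQ̃B − D̃(B) + C̃(B − hD̃(B)) = LQ̃B.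
It is easy to prove, following the proofs in the above mentioned papers, that there exists exactly one solution of
this equation, and that it is an analytic function of B. From this equation we obtain also that D̃(B) has an
expansion beginning with quadratic terms, and D̃⁽²⁾(B) = C̃⁽²⁾(B).»*

THE TYPING.  The tree's `B12Lineariz267.p267_linearizing_change_of_variables` (p07/p24 lineage) transcribes this
paragraph onto the contraction scheme `B13Contraction113` for ABSTRACT data: complex normed spaces `𝒴` (fields on
bonds of T⁽ᵏ⁾), `𝒳` complete (fields on bonds of T⁽ᵏ⁺¹⁾), `ℂ`-linear `LQ̃ : 𝒴 → 𝒳`, `h : 𝒳 → 𝒴` with `LQ̃h = I` and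
`‖h‖ ≤ b`, and a remainder `C̃ : 𝒴 → 𝒳` satisfying `QuadAnalytic C̃ C₂ R` (`‖C̃(Y)‖ ≤ C₂‖Y‖²` on `‖Y‖ < R` and
`ℂ`-differentiability of `ζ ↦ C̃(P + ζQ)`), under `9C₂bε < 1`, `3ε ≤ R`.  THIS MODULE INSTANTIATES IT for [I]'s GENUINE
`Q̃` of (2.4) over the averaged contour variables (0.11) on the `ℤᵈ` corner-cube carrier of the b12 lineage, at a
bondwise-`U1`, `ε₀`-regular background `V` (`‖V(∂p) − 1‖ ≤ ε₀` for all plaquettes, `(dL)²ε₀ ≤ 1/200`, Neumann budget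
`(Lᵈ/L)·24ω_A(ε₀) < 1`):
* `𝒴 = 𝒳 = ℓ^∞(bonds of ℤᵈ; 𝔸)` (`BField`, Mathlib `lp _ ⊤`, complete);
* `LQfield` = `Y ↦ (c ↦ (LQ̃_V Y)(c))` (`ℂ`-linear by r09 g9 `LQ_add/LQ_smul`, bounded by r09 g11 (L) `norm_LQ_le_of_global`);
* `hfield` = `X ↦ B13PkLocalTerms.hOp b₀ h X` with `h(c) = B12ContourAverage253.hAverage` (the lineage's Neumann inverse
  of the corridor coefficient), `LQ̃h = I` and `‖hX‖ ≤ H‖X‖` from `h_paragraph_p267_average`; its `ℂ`-LINEARITY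
  (`hc_smul`) from the two-sided inverse property (`hAverage_bcoef` + «LQ̃h = I» at one bond, `bcoef_hc`);
* `Cfield` = `Y ↦ (c ↦ Q̃_V(Y)(c) − (LQ̃_V Y)(c))` on the ball `‖Y‖·dL ≤ 1/1200` (bounded by (126)/(L)), `0` outside;
* **`quadAnalytic_Cfield`**: `QuadAnalytic Cfield (192000(dL)²) (1/(4800dL))` — the quadratic bound is r09 g11's (123)
  `norm_Qtilde_sub_LQ_le_of_global`; the `ℓ^∞`-valued line-differentiability is assembled (§ 1, two private lemmas:
  the second-order Cauchy remainder `‖f(z) − f(z₀) − (z−z₀)f′(z₀)‖ ≤ M|z−z₀|²/(r(r−|z−z₀|))` and «uniformly holomorphic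
  coordinates ⇒ `ℓ^∞`-holomorphic curve») from the coordinatewise analyticity `analyticAt_Qtilde_family` with the
  UNIFORM bound `1/20` on a common disc;
* **`p267_genuine`** = the tree theorem with every hypothesis discharged: for `9C₂Hε < 1`, `3ε ≤ R` there is
  `D̃ : ℓ^∞ → ℓ^∞` with `‖D̃(B)‖ ≤ 4C₂ε²`, `C̃_V(B − hD̃(B)) = D̃(B)`, the linearization identity, `‖D̃(B)‖ ≤ 4C₂‖B‖²`
  (quadratic start), `‖D̃(B) − C̃_V(B)‖ ≤ 36C₂²H‖B‖³` (`D̃⁽²⁾ = C̃⁽²⁾`), uniqueness in the ball, injectivity of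
  `Φ(B) = B − hD̃(B)` on `‖B‖ < ε` and `Φ` onto `‖B′‖ < ε/2`; **`linearizes_genuine`**: coordinatewise
  `Q̃_V(B − hD̃(B))(c) = (LQ̃_V B)(c)` («linearizes the function Q̃(B′)»).
DIVERGENCES FROM PRINT / HONEST SCOPE.  (a) `ℤᵈ` corner cubes and the lineage's (0.10)–(0.12) (`B12ContourAverage253`
(a)–(c)), bounded fields in `ℓ^∞` instead of all fields on a finite torus.  (b) «it is an analytic function of B» is NOT
formalised here: the tree's `B12LinearizAnalytic267` needs `C̃` Fréchet-analytic `ℓ^∞ → ℓ^∞`, which requires joint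
analyticity in infinitely many bond variables (only line-differentiability, `QuadAnalytic`, is proved); on a finite
bond set the coordinate maps are analytic on the quantitative ball (`B12QtildeRemainder123.analyticOnNhd_Qtilde_fields`).
(c) Constants explicit but crude (`C₂ = 192000(dL)²`, `R = 1/(4800dL)`, print: «ε₁ sufficiently small»).  (d) Linear
algebra over `𝔸` (a complete normed `ℂ`-algebra with `‖1‖ = 1`), no reality/trace structure of `𝐠`.

WHAT IS PROVED: definitions WITH BODIES (`BField`, `LQfield`, `hc`, `hfield`, `Cfield`) and theorems; no `Prop`-fact,
no sorry; axioms `propext`, `Classical.choice`, `Quot.sound`.  v1.1 (§ 5, append-only): NON-VACUITY at the flat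
background `V ≡ 1` (`flat_hypotheses`, `linearizes_genuine_flat`: a radius `ε > 0` exists for every `L, d ≥ 1`).
-/

noncomputable section

open NormedSpace Finset Metric Asymptotics Filter Topology

namespace Literature.MathematicalPhysics.QuantumFieldTheory.Balaban1983to89.B12LinearizationGenuineZd

open Literature.MathematicalPhysics.QuantumLattice (ZdEdge plaquetteHolonomyZd)
open B7Prop1Explicit (U1 mem_U1)
open B12AverageCorridor267 (Qtilde LQ pert_zero)
open B12ContourAverage253 (Tavg omegaA hAverage h_paragraph_p267_average)
open B12HOperator267 (bcoef)
open B13PkLocalTerms (hOp hOp_apply_b₀ hOp_eq_zero_off_range)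
open B13CorridorSeparation (b0Z b0Z_injective)
open B13Contraction113 (QuadAnalytic)
open B12Average012Analytic (LQ_add LQ_smul)
open B12LQLocalityBound267 (norm_LQ_le_of_global)
open B12QtildeRemainder123 (norm_Qtilde_sub_LQ_le_of_global norm_Qtilde_le)
open B12QtildeRemainder123 (analyticAt_Qtilde_family)
open B12B0RestrictionAverage267 (hAverage_bcoef)

/-! ## § 1  Two private one-variable lemmas: the second-order Cauchy remainder, and `ℓ^∞`-valued curves with
uniformly holomorphic coordinates -/

section Analysis

variable {F : Type*} [NormedAddCommGroup F] [NormedSpace ℂ F] [CompleteSpace F]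

/-- [folklore] **second-order Taylor remainder by Cauchy's formula**: for `f` holomorphic on the disc `|w − z₀| < r`
and continuous on its closure with `‖f‖ ≤ M` on the circle, and `|z − z₀| < r`,
`‖f(z) − f(z₀) − (z − z₀)f′(z₀)‖ ≤ M|z − z₀|²/(r(r − |z − z₀|))`
(`f(z) − f(z₀) − (z−z₀)f′(z₀) = (2πi)⁻¹∮ f(w)(z−z₀)²dw/((w−z₀)²(w−z))`). -/
private theorem norm_sub_sub_smul_deriv_le {f : ℂ → F} {z₀ z : ℂ} {r M : ℝ} (hf : DiffContOnCl ℂ f (ball z₀ r))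
    (hM : ∀ w ∈ sphere z₀ r, ‖f w‖ ≤ M) (hz : z ∈ ball z₀ r) :
    ‖f z - f z₀ - (z - z₀) • deriv f z₀‖ ≤ M * ‖z - z₀‖ ^ 2 / (r * (r - ‖z - z₀‖)) := by
  have hzr : ‖z - z₀‖ < r := by rwa [mem_ball, dist_eq_norm] at hz
  have hr : 0 < r := (norm_nonneg _).trans_lt hzr
  have hz₀ : z₀ ∈ ball z₀ r := mem_ball_self hr
  have hcont : ContinuousOn f (sphere z₀ r) := hf.continuousOn_ball.mono sphere_subset_closedBall
  -- Cauchy's formulas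
  have hc := hf.circleIntegral_sub_inv_smul hz
  have hc₀ := hf.circleIntegral_sub_inv_smul hz₀
  have hcd := hf.deriv_eq_smul_circleIntegral hr
  -- sphere facts
  have hsph : ∀ w ∈ sphere z₀ r, ‖w - z₀‖ = r ∧ w ≠ z₀ ∧ w ≠ z ∧ r - ‖z - z₀‖ ≤ ‖w - z‖ := fun w hw => by
    rw [mem_sphere, dist_eq_norm] at hw
    refine ⟨hw, ?_, ?_, ?_⟩
    · intro h; rw [h, sub_self, norm_zero] at hw; linarith
    · intro h; rw [h] at hw; linarith
    · have := norm_sub_norm_le (w - z₀) (z - z₀); rw [hw, sub_sub_sub_cancel_right] at this; linarith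
  -- integrability
  have hint : ∀ u : ℂ, (∀ w ∈ sphere z₀ r, w ≠ u) → CircleIntegrable (fun w => (w - u)⁻¹ • f w) z₀ r := fun u hu =>
    (((continuousOn_id.sub continuousOn_const).inv₀ fun w hw => sub_ne_zero.2 (hu w hw)).smul hcont).circleIntegrable
      hr.le
  have hintz := hint z fun w hw => (hsph w hw).2.2.1
  have hint₀ := hint z₀ fun w hw => (hsph w hw).2.1
  have hint2 : CircleIntegrable (fun w => (z - z₀) • ((1 / (w - z₀) ^ 2) • f w)) z₀ r :=
    (continuousOn_const.smul (((continuousOn_const).div ((continuousOn_id.sub continuousOn_const).pow 2)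
      fun w hw => pow_ne_zero 2 (sub_ne_zero.2 (hsph w hw).2.1)).smul hcont)).circleIntegrable hr.le
  have hint1 : CircleIntegrable (fun w => (w - z)⁻¹ • f w - (w - z₀)⁻¹ • f w) z₀ r := hintz.sub hint₀
  -- the combined kernel integrates to `(2πi)(f z − f z₀ − (z − z₀) f′ z₀)`
  have hcomb : (∮ w in C(z₀, r), ((w - z)⁻¹ • f w - (w - z₀)⁻¹ • f w - (z - z₀) • ((1 / (w - z₀) ^ 2) • f w)))
      = (2 * Real.pi * Complex.I : ℂ) • (f z - f z₀ - (z - z₀) • deriv f z₀) := by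
    have e1 := circleIntegral.integral_sub hint1 hint2
    have e2 := circleIntegral.integral_sub hintz hint₀
    have e3 := circleIntegral.integral_smul (z - z₀) (fun w => (1 / (w - z₀) ^ 2) • f w) z₀ r
    rw [e1, e2, e3, hc, hc₀, hcd, smul_sub, smul_sub, smul_comm (z - z₀)]
  -- pointwise bound of the combined kernel on the circle
  have hr1 : 0 < r - ‖z - z₀‖ := by linarith
  have hker : ∀ w ∈ sphere z₀ r,
      ‖(w - z)⁻¹ • f w - (w - z₀)⁻¹ • f w - (z - z₀) • ((1 / (w - z₀) ^ 2) • f w)‖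
        ≤ ‖z - z₀‖ ^ 2 / (r ^ 2 * (r - ‖z - z₀‖)) * M := by
    intro w hw
    obtain ⟨hwn, hw₀, hwz, hwz'⟩ := hsph w hw
    have hw₀' : w - z₀ ≠ 0 := sub_ne_zero.2 hw₀
    have hwz'' : w - z ≠ 0 := sub_ne_zero.2 hwz
    have hid : (w - z)⁻¹ • f w - (w - z₀)⁻¹ • f w - (z - z₀) • ((1 / (w - z₀) ^ 2) • f w)
        = ((z - z₀) ^ 2 / ((w - z₀) ^ 2 * (w - z))) • f w := by
      rw [smul_smul, ← sub_smul, ← sub_smul]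
      congr 1
      field_simp
      ring
    rw [hid, norm_smul]
    refine mul_le_mul ?_ (hM w hw) (norm_nonneg _) (by positivity)
    rw [norm_div, norm_pow, norm_mul, norm_pow, hwn]
    exact div_le_div_of_nonneg_left (by positivity) (by positivity) (mul_le_mul_of_nonneg_left hwz' (by positivity))
  have hnorm := circleIntegral.norm_two_pi_i_inv_smul_integral_le_of_norm_le_const hr.le hker
  rw [hcomb, inv_smul_smul₀ Complex.two_pi_I_ne_zero] at hnorm
  refine hnorm.trans (le_of_eq ?_)
  rw [div_mul_eq_mul_div, mul_div_assoc', div_eq_div_iff (by positivity) (by positivity)]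
  ring

/-- [folklore] **an `ℓ^∞`-valued curve whose coordinates are holomorphic on a common disc with a common bound is
complex-differentiable**, with derivative the coordinatewise derivative (uniform second-order Cauchy remainders). -/
private theorem hasDerivAt_lp_of_coord {ι : Type*} (G : ℂ → lp (fun _ : ι => F) ⊤) (g : ι → ℂ → F) {ζ₀ : ℂ}
    {r M : ℝ} (hr : 0 < r) (hM0 : 0 ≤ M) (hG : ∀ ζ ∈ ball ζ₀ r, ∀ i, (G ζ : ι → F) i = g i ζ)
    (hg : ∀ i, DiffContOnCl ℂ (g i) (ball ζ₀ r)) (hM : ∀ i, ∀ z ∈ sphere ζ₀ r, ‖g i z‖ ≤ M)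
    (D : lp (fun _ : ι => F) ⊤) (hD : ∀ i, (D : ι → F) i = deriv (g i) ζ₀) :
    HasDerivAt G D ζ₀ := by
  rw [hasDerivAt_iff_isLittleO, isLittleO_iff]
  intro c hc
  have hδ : 0 < min (r / 2) (c * r ^ 2 / (2 * M + 1)) := lt_min (by positivity) (by positivity)
  filter_upwards [ball_mem_nhds ζ₀ hδ] with ζ hζ
  rw [mem_ball, dist_eq_norm, lt_min_iff] at hζ
  obtain ⟨hζr, hζc⟩ := hζ
  have hζball : ζ ∈ ball ζ₀ r := by rw [mem_ball, dist_eq_norm]; linarith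
  have hζ₀ball : ζ₀ ∈ ball ζ₀ r := mem_ball_self hr
  -- coordinatewise second-order remainder
  have hcoord : ∀ i, ‖(G ζ - G ζ₀ - (ζ - ζ₀) • D : lp (fun _ : ι => F) ⊤) i‖ ≤ 2 * M / r ^ 2 * ‖ζ - ζ₀‖ ^ 2 := by
    intro i
    have e : (G ζ - G ζ₀ - (ζ - ζ₀) • D : lp (fun _ : ι => F) ⊤) i = g i ζ - g i ζ₀ - (ζ - ζ₀) • deriv (g i) ζ₀ := by
      simp only [lp.coeFn_sub, lp.coeFn_smul, Pi.sub_apply, Pi.smul_apply, hG ζ hζball, hG ζ₀ hζ₀ball, hD]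
    rw [e]
    refine (norm_sub_sub_smul_deriv_le (hg i) (hM i) hζball).trans ?_
    have hpos : 0 < r * (r - ‖ζ - ζ₀‖) := by nlinarith
    rw [div_le_iff₀ hpos]
    have hkey : r * (r / 2) ≤ r * (r - ‖ζ - ζ₀‖) := mul_le_mul_of_nonneg_left (by linarith) hr.le
    calc M * ‖ζ - ζ₀‖ ^ 2 = 2 * M / r ^ 2 * ‖ζ - ζ₀‖ ^ 2 * (r * (r / 2)) := by field_simp
      _ ≤ 2 * M / r ^ 2 * ‖ζ - ζ₀‖ ^ 2 * (r * (r - ‖ζ - ζ₀‖)) := mul_le_mul_of_nonneg_left hkey (by positivity)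
  have hsup : ‖(G ζ - G ζ₀ - (ζ - ζ₀) • D : lp (fun _ : ι => F) ⊤)‖ ≤ 2 * M / r ^ 2 * ‖ζ - ζ₀‖ ^ 2 :=
    lp.norm_le_of_forall_le (by positivity) hcoord
  refine hsup.trans ?_
  rw [pow_two ‖ζ - ζ₀‖, ← mul_assoc]
  refine mul_le_mul_of_nonneg_right ?_ (norm_nonneg _)
  have h1 : 2 * M / r ^ 2 * ‖ζ - ζ₀‖ ≤ 2 * M / r ^ 2 * (c * r ^ 2 / (2 * M + 1)) :=
    mul_le_mul_of_nonneg_left hζc.le (by positivity)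
  refine h1.trans ?_
  rw [show 2 * M / r ^ 2 * (c * r ^ 2 / (2 * M + 1)) = c * (2 * M / (2 * M + 1)) by field_simp]
  have : 2 * M / (2 * M + 1) ≤ 1 := by rw [div_le_one (by positivity)]; linarith
  calc c * (2 * M / (2 * M + 1)) ≤ c * 1 := mul_le_mul_of_nonneg_left this hc.le
    _ = c := mul_one c

end Analysis

/-! ## § 2  The three maps of p. 267 on the Banach space `ℓ^∞` of bounded bond fields on `ℤᵈ` -/

section Maps

variable {d : ℕ}
variable {𝔸 : Type*} [NormedRing 𝔸] [NormedAlgebra ℂ 𝔸] [NormOneClass 𝔸] [CompleteSpace 𝔸] {L : ℕ}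

/-- [cite: Balaban1987RG1, p.267] the Banach space `ℓ^∞(bonds of ℤᵈ; 𝔸)` of bounded bond fields, sup norm — print's
«𝐠-valued functions B defined at bonds of the lattice T⁽ᵏ⁺¹⁾», resp. «at bonds of T⁽ᵏ⁾» (one index type for both:
the coarse lattice is read on the fine one through `b₀(c)`, `B(c_±)` as everywhere in the b12 lineage; DIVERGENCE:
`ℤᵈ` and bounded fields, not the finite torus). -/
abbrev BField (d : ℕ) (𝔸 : Type*) [NormedAddCommGroup 𝔸] : Type _ := lp (fun _ : ZdEdge d => 𝔸) ⊤

variable (hL : 0 < L) (hd : 1 ≤ d) (V : ZdEdge d → 𝔸ˣ) (hV : ∀ b, V b ∈ U1 𝔸) {ε₀ : ℝ} (hε₀ : 0 ≤ ε₀)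
  (hsm : ((d : ℝ) * L) ^ 2 * ε₀ ≤ 1 / 200)
  (h44 : ∀ (p : Fin d → ℤ) (i j : Fin d), i ≠ j → ‖((plaquetteHolonomyZd V p i j : 𝔸ˣ) : 𝔸) - 1‖ ≤ ε₀)

omit [NormedRing 𝔸] [NormedAlgebra ℂ 𝔸] [NormOneClass 𝔸] [CompleteSpace 𝔸] in
/-- [folklore] `(dL)²ε₀ ≤ 1/200` gives `ω_A(ε₀) = 10(dL)²ε₀ ≤ 1/8`. -/
private theorem omegaA_le_of_small (h : ((d : ℝ) * L) ^ 2 * ε₀ ≤ 1 / 200) : omegaA d L ε₀ ≤ 1 / 8 := by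
  have : omegaA d L ε₀ = 10 * (((d : ℝ) * L) ^ 2 * ε₀) := by unfold omegaA; ring
  rw [this]; linarith

/-- [cite: Balaban1987RG1, p.267] **`LQ̃_V` ON `ℓ^∞`**: `Y ↦ (c ↦ (LQ̃_V Y)(c))`, a `ℂ`-linear self-map of the bounded
bond fields (linear by `B12Average012Analytic.LQ_add/LQ_smul`, bounded by `B12LQLocalityBound267.norm_LQ_le_of_global`:
`‖(LQ̃_V Y)(c)‖ ≤ 40dL‖Y‖`), at a bondwise-`U1`, `ε₀`-regular `V` with `(dL)²ε₀ ≤ 1/200`. -/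
def LQfield : BField d 𝔸 →ₗ[ℂ] BField d 𝔸 where
  toFun Y := ⟨fun c => LQ L (fun U : ZdEdge d → 𝔸ˣ => Tavg L U) V (⇑Y) c, memℓp_infty ⟨40 * ((d : ℝ) * L) * ‖Y‖, by
    rintro _ ⟨c, rfl⟩
    dsimp only
    exact norm_LQ_le_of_global hL hd V hV hε₀ hsm h44 (fun b => lp.norm_apply_le_norm ENNReal.top_ne_zero Y b) c⟩⟩
  map_add' Y Y' := lp.ext <| funext fun c => by
    show LQ L (fun U : ZdEdge d → 𝔸ˣ => Tavg L U) V (⇑(Y + Y')) c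
      = LQ L (fun U : ZdEdge d → 𝔸ˣ => Tavg L U) V (⇑Y) c + LQ L (fun U : ZdEdge d → 𝔸ˣ => Tavg L U) V (⇑Y') c
    rw [lp.coeFn_add]
    exact LQ_add hL hd V hV hε₀ (by linarith) h44 _ _ c
  map_smul' a Y := lp.ext <| funext fun c => by
    show LQ L (fun U : ZdEdge d → 𝔸ˣ => Tavg L U) V (⇑(a • Y)) c
      = a • LQ L (fun U : ZdEdge d → 𝔸ˣ => Tavg L U) V (⇑Y) c
    rw [lp.coeFn_smul]
    exact LQ_smul hL hd V hV hε₀ (by linarith) h44 a _ c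

/-- [cite: Balaban1987RG1, p.267] unfolding: the `c`-coordinate of `LQ̃_V Y` is `(LQ̃_V Y)(c)`. -/
theorem LQfield_apply (Y : BField d 𝔸) (c : ZdEdge d) :
    (LQfield hL hd V hV hε₀ hsm h44 Y : ZdEdge d → 𝔸) c = LQ L (fun U : ZdEdge d → 𝔸ˣ => Tavg L U) V (⇑Y) c := rfl

variable (hbud : (L : ℝ) ^ d / L * (24 * omegaA d L ε₀) < 1)

/-- [cite: Balaban1987RG1, p.267] **`h(c)` OF THE GENUINE AVERAGE** («a linear operator on the Lie algebra 𝐠, equal to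
an inverse of a coefficient at the variable B′(b₀(c)) in (Q̃B′)(c)»): the lineage's `B12ContourAverage253.hAverage`
with the smallness bookkeeping of this file. -/
def hc (c : ZdEdge d) : 𝔸 →L[ℝ] 𝔸 :=
  hAverage hL hd V (fun b => (mem_U1.1 (hV b)).1) (fun b => (mem_U1.1 (hV b)).2) hε₀ h44 (hsm.trans (by norm_num))
    (omegaA_le_of_small hsm) hbud c

/-- [cite: Balaban1987RG1, p.267] the three clauses of the `h`-paragraph for `hc` (= `h_paragraph_p267_average`):
«LQ̃h = I», uniqueness, and the bound `‖h(c)X‖ ≤ H·‖X‖`, `H = (Lᵈ/L)/(1 − (Lᵈ/L)·24ω_A(ε₀))`. -/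
theorem hc_spec :
    (∀ B c, LQ L (fun U : ZdEdge d → 𝔸ˣ => Tavg L U) V
        (hOp (b0Z L) (fun c X => hc hL hd V hV hε₀ hsm h44 hbud c X) B) c = B c) ∧
    (∀ c X, ‖hc hL hd V hV hε₀ hsm h44 hbud c X‖
        ≤ ((L : ℝ) ^ d / L) / (1 - (L : ℝ) ^ d / L * (24 * omegaA d L ε₀)) * ‖X‖) := by
  obtain ⟨h1, -, h3⟩ := h_paragraph_p267_average hL hd V (fun b => (mem_U1.1 (hV b)).1)
    (fun b => (mem_U1.1 (hV b)).2) hε₀ h44 (hsm.trans (by norm_num)) (omegaA_le_of_small hsm) hbud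
  exact ⟨h1, h3⟩

/-- [cite: Balaban1987RG1, p.267] `h(c)` is a RIGHT inverse of the corridor coefficient of `LQ̃_V` («LQ̃h = I» read at
the single coarse bond `c`). -/
theorem bcoef_hc (c : ZdEdge d) (y : 𝔸) :
    bcoef L (LQ L (fun U : ZdEdge d → 𝔸ˣ => Tavg L U) V) c (hc hL hd V hV hε₀ hsm h44 hbud c y) = y := by
  classical
  have h := (hc_spec hL hd V hV hε₀ hsm h44 hbud).1 (Pi.single c y) c
  rw [Pi.single_eq_same] at h
  have e : hOp (b0Z L) (fun c X => hc hL hd V hV hε₀ hsm h44 hbud c X) (Pi.single c y : ZdEdge d → 𝔸)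
      = Pi.single (b0Z L c) (hc hL hd V hV hε₀ hsm h44 hbud c y) := by
    funext b
    by_cases hb : ∃ c', b0Z L c' = b
    · obtain ⟨c', rfl⟩ := hb
      rw [hOp_apply_b₀ (b0Z_injective hL)]
      by_cases hcc : c' = c
      · subst hcc; rw [Pi.single_eq_same, Pi.single_eq_same]
      · rw [Pi.single_eq_of_ne hcc, Pi.single_eq_of_ne (fun h => hcc (b0Z_injective hL h)), map_zero]
    · rw [hOp_eq_zero_off_range _ _ hb, Pi.single_eq_of_ne]
      rintro rfl; exact hb ⟨c, rfl⟩
  rw [e] at h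
  exact h

/-- [cite: Balaban1987RG1, p.267] **`h(c)` IS `ℂ`-LINEAR** (print: «a linear operator on the Lie algebra 𝐠»; the tree
types it `ℝ`-linearly): a two-sided inverse (`hAverage_bcoef`, `bcoef_hc`) of the `ℂ`-linear coefficient of `LQ̃_V`. -/
theorem hc_smul (c : ZdEdge d) (a : ℂ) (x : 𝔸) :
    hc hL hd V hV hε₀ hsm h44 hbud c (a • x) = a • hc hL hd V hV hε₀ hsm h44 hbud c x := by
  have hlin : ∀ v : 𝔸, bcoef L (LQ L (fun U : ZdEdge d → 𝔸ˣ => Tavg L U) V) c (a • v)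
      = a • bcoef L (LQ L (fun U : ZdEdge d → 𝔸ˣ => Tavg L U) V) c v := fun v => by
    unfold bcoef
    rw [Pi.single_smul, LQ_smul hL hd V hV hε₀ (by linarith) h44]
  have hleft := hAverage_bcoef hL hd V (fun b => (mem_U1.1 (hV b)).1) (fun b => (mem_U1.1 (hV b)).2) hε₀ h44
    (hsm.trans (by norm_num)) (omegaA_le_of_small hsm) hbud c (a • hc hL hd V hV hε₀ hsm h44 hbud c x)
  rw [hlin, bcoef_hc] at hleft
  exact hleft

/-- [cite: Balaban1987RG1, p.267] **THE OPERATOR `h` ON `ℓ^∞`** («The function hB is equal to 0 everywhere, except the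
set {b₀(c) : c ∈ T⁽ᵏ⁺¹⁾} … (hB)(b₀(c)) = h(c)B(c)»): `X ↦ hD̃`-shaped field `B13PkLocalTerms.hOp b₀ h X`, a `ℂ`-linear
self-map of the bounded bond fields with `‖hX‖ ≤ H‖X‖`. -/
def hfield : BField d 𝔸 →ₗ[ℂ] BField d 𝔸 where
  toFun X := ⟨hOp (b0Z L) (fun c x => hc hL hd V hV hε₀ hsm h44 hbud c x) ⇑X, memℓp_infty
    ⟨((L : ℝ) ^ d / L) / (1 - (L : ℝ) ^ d / L * (24 * omegaA d L ε₀)) * ‖X‖, by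
      rintro _ ⟨b, rfl⟩
      dsimp only
      by_cases hb : ∃ c, b0Z L c = b
      · obtain ⟨c, rfl⟩ := hb
        rw [hOp_apply_b₀ (b0Z_injective hL)]
        exact ((hc_spec hL hd V hV hε₀ hsm h44 hbud).2 c _).trans (mul_le_mul_of_nonneg_left
          (lp.norm_apply_le_norm ENNReal.top_ne_zero X c) (B12B0RestrictionAverage267.H_nonneg L d hbud))
      · rw [hOp_eq_zero_off_range _ _ hb, norm_zero]
        exact mul_nonneg (B12B0RestrictionAverage267.H_nonneg L d hbud) (norm_nonneg _)⟩⟩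
  map_add' X X' := lp.ext <| funext fun b => by
    show hOp (b0Z L) (fun c x => hc hL hd V hV hε₀ hsm h44 hbud c x) (⇑(X + X')) b
      = hOp (b0Z L) (fun c x => hc hL hd V hV hε₀ hsm h44 hbud c x) (⇑X) b
        + hOp (b0Z L) (fun c x => hc hL hd V hV hε₀ hsm h44 hbud c x) (⇑X') b
    rw [lp.coeFn_add]
    by_cases hb : ∃ c, b0Z L c = b
    · obtain ⟨c, rfl⟩ := hb
      simp only [hOp_apply_b₀ (b0Z_injective hL), Pi.add_apply, map_add]
    · simp only [hOp_eq_zero_off_range _ _ hb, add_zero]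
  map_smul' a X := lp.ext <| funext fun b => by
    show hOp (b0Z L) (fun c x => hc hL hd V hV hε₀ hsm h44 hbud c x) (⇑(a • X)) b
      = a • hOp (b0Z L) (fun c x => hc hL hd V hV hε₀ hsm h44 hbud c x) (⇑X) b
    rw [lp.coeFn_smul]
    by_cases hb : ∃ c, b0Z L c = b
    · obtain ⟨c, rfl⟩ := hb
      simp only [hOp_apply_b₀ (b0Z_injective hL), Pi.smul_apply]
      exact hc_smul hL hd V hV hε₀ hsm h44 hbud c a (X c)
    · simp only [hOp_eq_zero_off_range _ _ hb, smul_zero]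

/-- [cite: Balaban1987RG1, p.267] unfolding: `hX` is the field «(hB)(b₀(c)) = h(c)B(c)», `0` elsewhere. -/
theorem hfield_apply (X : BField d 𝔸) :
    ((hfield hL hd V hV hε₀ hsm h44 hbud X : BField d 𝔸) : ZdEdge d → 𝔸)
      = hOp (b0Z L) (fun c x => hc hL hd V hV hε₀ hsm h44 hbud c x) ⇑X := rfl

/-- [cite: Balaban1987RG1, p.267] «LQ̃h = I on T⁽ᵏ⁺¹⁾» on `ℓ^∞`. -/
theorem LQfield_hfield (X : BField d 𝔸) :
    LQfield hL hd V hV hε₀ hsm h44 (hfield hL hd V hV hε₀ hsm h44 hbud X) = X :=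
  lp.ext <| funext fun c => by
    rw [LQfield_apply, hfield_apply]
    exact (hc_spec hL hd V hV hε₀ hsm h44 hbud).1 (⇑X) c

/-- [cite: Balaban1987RG1, p.267] the bound `‖hX‖ ≤ H‖X‖`, `H = (Lᵈ/L)/(1 − (Lᵈ/L)·24ω_A(ε₀))`. -/
theorem norm_hfield_le (X : BField d 𝔸) :
    ‖hfield hL hd V hV hε₀ hsm h44 hbud X‖ ≤ ((L : ℝ) ^ d / L) / (1 - (L : ℝ) ^ d / L * (24 * omegaA d L ε₀)) * ‖X‖ := by
  refine lp.norm_le_of_forall_le (mul_nonneg (B12B0RestrictionAverage267.H_nonneg L d hbud) (norm_nonneg _)) fun b => ?_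
  rw [hfield_apply]
  by_cases hb : ∃ c, b0Z L c = b
  · obtain ⟨c, rfl⟩ := hb
    rw [hOp_apply_b₀ (b0Z_injective hL)]
    exact ((hc_spec hL hd V hV hε₀ hsm h44 hbud).2 c _).trans (mul_le_mul_of_nonneg_left
      (lp.norm_apply_le_norm ENNReal.top_ne_zero X c) (B12B0RestrictionAverage267.H_nonneg L d hbud))
  · rw [hOp_eq_zero_off_range _ _ hb, norm_zero]
    exact mul_nonneg (B12B0RestrictionAverage267.H_nonneg L d hbud) (norm_nonneg _)

/-- [folklore] membership of the remainder field in `ℓ^∞` on the small ball. -/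
private theorem memℓp_Qtilde_sub_LQ (hL : 0 < L) (hd : 1 ≤ d) (V : ZdEdge d → 𝔸ˣ) (hV : ∀ b, V b ∈ U1 𝔸)
    {ε₀ : ℝ} (hε₀ : 0 ≤ ε₀) (hsm : ((d : ℝ) * L) ^ 2 * ε₀ ≤ 1 / 200)
    (h44 : ∀ (p : Fin d → ℤ) (i j : Fin d), i ≠ j → ‖((plaquetteHolonomyZd V p i j : 𝔸ˣ) : 𝔸) - 1‖ ≤ ε₀)
    (Y : BField d 𝔸) (hY : ‖Y‖ * ((d : ℝ) * L) ≤ 1 / 1200) :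
    Memℓp (fun c : ZdEdge d => Qtilde L (fun U : ZdEdge d → 𝔸ˣ => Tavg L U) V (⇑Y) c
      - LQ L (fun U : ZdEdge d → 𝔸ˣ => Tavg L U) V (⇑Y) c) ⊤ :=
  memℓp_infty ⟨40 * (‖Y‖ * ((d : ℝ) * L)) + 40 * ((d : ℝ) * L) * ‖Y‖, by
    rintro _ ⟨c, rfl⟩
    dsimp only
    exact (norm_sub_le _ _).trans (add_le_add
      (norm_Qtilde_le hL hd V hV hε₀ hsm h44 (fun b => lp.norm_apply_le_norm ENNReal.top_ne_zero Y b) hY c)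
      (norm_LQ_le_of_global hL hd V hV hε₀ hsm h44 (fun b => lp.norm_apply_le_norm ENNReal.top_ne_zero Y b) c))⟩

/-- [cite: Balaban1987RG1, p.267][cite: Balaban1985Averaging, (122) p.36] **THE REMAINDER `C̃_V = Q̃_V − LQ̃_V` ON
`ℓ^∞`** («LQ̃B′ + C̃(B′)»): `Y ↦ (c ↦ Q̃_V(Y)(c) − (LQ̃_V Y)(c))` on the ball `‖Y‖·dL ≤ 1/1200` (bounded there by
`B12QtildeRemainder123.norm_Qtilde_le` and `norm_LQ_le_of_global`), extended by `0` outside (the scheme only sees the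
ball). -/
def Cfield : BField d 𝔸 → BField d 𝔸 := fun Y =>
  if hY : ‖Y‖ * ((d : ℝ) * L) ≤ 1 / 1200 then
    ⟨fun c => Qtilde L (fun U : ZdEdge d → 𝔸ˣ => Tavg L U) V (⇑Y) c - LQ L (fun U : ZdEdge d → 𝔸ˣ => Tavg L U) V (⇑Y) c,
      memℓp_Qtilde_sub_LQ hL hd V hV hε₀ hsm h44 Y hY⟩
  else 0

/-- [cite: Balaban1987RG1, p.267] unfolding on the ball: the `c`-coordinate of `C̃_V(Y)` is `Q̃_V(Y)(c) − (LQ̃_V Y)(c)`. -/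
theorem Cfield_apply (Y : BField d 𝔸) (hY : ‖Y‖ * ((d : ℝ) * L) ≤ 1 / 1200) (c : ZdEdge d) :
    ((Cfield hL hd V hV hε₀ hsm h44 Y : BField d 𝔸) : ZdEdge d → 𝔸) c
      = Qtilde L (fun U : ZdEdge d → 𝔸ˣ => Tavg L U) V (⇑Y) c - LQ L (fun U : ZdEdge d → 𝔸ˣ => Tavg L U) V (⇑Y) c := by
  unfold Cfield; rw [dif_pos hY]

/-- [cite: Balaban1987RG1, (2.4) p.266][cite: Balaban1985Averaging, (122) p.36] (122) on `ℓ^∞`: `LQ̃_V Y + C̃_V(Y) = Q̃_V(Y)`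
coordinatewise on the ball. -/
theorem LQfield_add_Cfield_apply (Y : BField d 𝔸) (hY : ‖Y‖ * ((d : ℝ) * L) ≤ 1 / 1200) (c : ZdEdge d) :
    ((LQfield hL hd V hV hε₀ hsm h44 Y + Cfield hL hd V hV hε₀ hsm h44 Y : BField d 𝔸) : ZdEdge d → 𝔸) c
      = Qtilde L (fun U : ZdEdge d → 𝔸ˣ => Tavg L U) V (⇑Y) c := by
  rw [lp.coeFn_add, Pi.add_apply, LQfield_apply, Cfield_apply hL hd V hV hε₀ hsm h44 Y hY, add_sub_cancel]

/-! ## § 3  `C̃_V` is `QuadAnalytic` on `ℓ^∞` ([B7] (123) + line analyticity): the hypothesis of the scheme -/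

/-- [cite: Balaban1985Averaging, (123) p.36][cite: Balaban1987RG1, p.267][cite: Balaban1985Variational, p.286] **`C̃_V`
SATISFIES THE SCHEME'S HYPOTHESIS `B13Contraction113.QuadAnalytic C̃ C₂ R`** with `C₂ = 192000(dL)²`,
`R = 1/(4800dL)`: the quadratic bound is `B12QtildeRemainder123.norm_Qtilde_sub_LQ_le_of_global`; analyticity along
every complex line `ζ ↦ C̃_V(P + ζQ)` in `ℓ^∞` from the coordinatewise analyticity `analyticAt_Qtilde_family` with the
UNIFORM bound `1/20` on a common disc (§ 1). -/
theorem quadAnalytic_Cfield :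
    QuadAnalytic (Cfield hL hd V hV hε₀ hsm h44) (192000 * ((d : ℝ) * L) ^ 2) (1 / (4800 * ((d : ℝ) * L))) := by
  have hdL : 0 < (d : ℝ) * L := by
    have : (1 : ℝ) ≤ d := by exact_mod_cast hd
    have : (0 : ℝ) < L := by exact_mod_cast hL
    positivity
  have hsmall : ∀ Y : BField d 𝔸, ‖Y‖ < 1 / (4800 * ((d : ℝ) * L)) → ‖Y‖ * ((d : ℝ) * L) < 1 / 4800 := fun Y hY => by
    rw [lt_div_iff₀ (by positivity)] at hY; linarith
  refine ⟨fun Y hY => ?_, fun P Q => ?_⟩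
  · have hY' := hsmall Y hY
    refine lp.norm_le_of_forall_le (by positivity) fun c => ?_
    rw [Cfield_apply hL hd V hV hε₀ hsm h44 Y (by linarith) c]
    calc _ ≤ 192000 * (‖Y‖ * ((d : ℝ) * L)) ^ 2 := norm_Qtilde_sub_LQ_le_of_global hL hd V hV hε₀ hsm h44
          (fun b => lp.norm_apply_le_norm ENNReal.top_ne_zero Y b) hY'.le c
      _ = 192000 * ((d : ℝ) * L) ^ 2 * ‖Y‖ ^ 2 := by ring
  · intro ζ₀ hζ₀
    refine DifferentiableAt.differentiableWithinAt ?_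
    have hζ₀' := hsmall _ hζ₀
    by_cases hQ : Q = 0
    · simp only [hQ, smul_zero, add_zero]; exact differentiableAt_const _
    have hQn : 0 < ‖Q‖ := norm_pos_iff.2 hQ
    set r : ℝ := 1 / (2400 * ((d : ℝ) * L) * ‖Q‖) with hr
    have hr0 : 0 < r := by positivity
    have hrQ : r * ‖Q‖ * ((d : ℝ) * L) = 1 / 2400 := by rw [hr]; field_simp
    -- the whole closed disc stays in the ball `‖·‖dL ≤ 1/1600`
    have hmem : ∀ ζ : ℂ, ‖ζ - ζ₀‖ ≤ r → ‖P + ζ • Q‖ * ((d : ℝ) * L) ≤ 1 / 1600 := fun ζ hζ => by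
      have h1 : ‖P + ζ • Q‖ ≤ ‖P + ζ₀ • Q‖ + ‖ζ - ζ₀‖ * ‖Q‖ := by
        have : P + ζ • Q = (P + ζ₀ • Q) + (ζ - ζ₀) • Q := by rw [sub_smul]; abel
        rw [this]
        exact (norm_add_le _ _).trans (by rw [norm_smul])
      have h2 : ‖ζ - ζ₀‖ * ‖Q‖ * ((d : ℝ) * L) ≤ 1 / 2400 := by
        rw [← hrQ]; exact mul_le_mul_of_nonneg_right (mul_le_mul_of_nonneg_right hζ hQn.le) hdL.le
      have h3 := mul_le_mul_of_nonneg_right h1 hdL.le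
      rw [add_mul] at h3
      linarith
    -- the coordinates
    set g : ZdEdge d → ℂ → 𝔸 := fun c ζ =>
      Qtilde L (fun U : ZdEdge d → 𝔸ˣ => Tavg L U) V (⇑(P + ζ • Q)) c
        - LQ L (fun U : ZdEdge d → 𝔸ˣ => Tavg L U) V (⇑(P + ζ • Q)) c
    have hG : ∀ ζ ∈ ball ζ₀ r, ∀ c,
        ((Cfield hL hd V hV hε₀ hsm h44 (P + ζ • Q) : BField d 𝔸) : ZdEdge d → 𝔸) c = g c ζ := fun ζ hζ c => by
      rw [mem_ball, dist_eq_norm] at hζ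
      rw [Cfield_apply hL hd V hV hε₀ hsm h44 _ ((hmem ζ hζ.le).trans (by norm_num)) c]
    have han : ∀ c, ∀ ζ ∈ closedBall ζ₀ r, AnalyticAt ℂ (g c) ζ := fun c ζ hζ => by
      rw [mem_closedBall, dist_eq_norm] at hζ
      have hB : ∀ b, AnalyticAt ℂ (fun t : ℂ => ((P + t • Q : BField d 𝔸) : ZdEdge d → 𝔸) b) ζ := fun b => by
        simp only [lp.coeFn_add, lp.coeFn_smul, Pi.add_apply, Pi.smul_apply]
        exact analyticAt_const.add (analyticAt_id.smul analyticAt_const)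
      have hβ : ∀ b, ‖((P + ζ • Q : BField d 𝔸) : ZdEdge d → 𝔸) b‖ ≤ ‖P + ζ • Q‖ := fun b =>
        lp.norm_apply_le_norm ENNReal.top_ne_zero _ b
      have h1 := analyticAt_Qtilde_family hL hd hV hε₀ hsm h44
        (fun t : ℂ => ((P + t • Q : BField d 𝔸) : ZdEdge d → 𝔸)) hB hβ ((hmem ζ hζ).trans (by norm_num)) c
      have h2 : AnalyticAt ℂ (fun t : ℂ => LQ L (fun U : ZdEdge d → 𝔸ˣ => Tavg L U) V
          (((P + t • Q : BField d 𝔸) : ZdEdge d → 𝔸)) c) ζ := by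
        have e : (fun t : ℂ => LQ L (fun U : ZdEdge d → 𝔸ˣ => Tavg L U) V
            (((P + t • Q : BField d 𝔸) : ZdEdge d → 𝔸)) c) = fun t =>
            LQ L (fun U : ZdEdge d → 𝔸ˣ => Tavg L U) V (⇑P) c
              + t • LQ L (fun U : ZdEdge d → 𝔸ˣ => Tavg L U) V (⇑Q) c := funext fun t => by
          rw [lp.coeFn_add, lp.coeFn_smul, LQ_add hL hd V hV hε₀ (by linarith) h44,
            LQ_smul hL hd V hV hε₀ (by linarith) h44]
        rw [e]
        exact analyticAt_const.add (analyticAt_id.smul analyticAt_const)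
      exact h1.sub h2
    have hgd : ∀ c, DiffContOnCl ℂ (g c) (ball ζ₀ r) := fun c =>
      DifferentiableOn.diffContOnCl fun ζ hζ =>
        (han c ζ (closure_ball_subset_closedBall hζ)).differentiableAt.differentiableWithinAt
    have hMg : ∀ c, ∀ z ∈ sphere ζ₀ r, ‖g c z‖ ≤ 1 / 20 := fun c z hz => by
      have hz' : ‖z - ζ₀‖ ≤ r := by rw [mem_sphere, dist_eq_norm] at hz; exact hz.le
      have hY := hmem z hz'
      have hβ : ∀ b, ‖((P + z • Q : BField d 𝔸) : ZdEdge d → 𝔸) b‖ ≤ ‖P + z • Q‖ := fun b =>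
        lp.norm_apply_le_norm ENNReal.top_ne_zero _ b
      have h1 := norm_Qtilde_le hL hd V hV hε₀ hsm h44 hβ (hY.trans (by norm_num)) c
      have h2 := norm_LQ_le_of_global hL hd V hV hε₀ hsm h44 hβ c
      calc ‖g c z‖ ≤ 40 * (‖P + z • Q‖ * ((d : ℝ) * L)) + 40 * ((d : ℝ) * L) * ‖P + z • Q‖ :=
            (norm_sub_le _ _).trans (add_le_add h1 h2)
        _ = 80 * (‖P + z • Q‖ * ((d : ℝ) * L)) := by ring
        _ ≤ 1 / 20 := by linarith
    -- the derivative, an element of `ℓ^∞` by Cauchy's estimate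
    have hDmem : Memℓp (fun c : ZdEdge d => deriv (g c) ζ₀) ⊤ := memℓp_infty ⟨1 / 20 / r, by
      rintro _ ⟨c, rfl⟩
      dsimp only
      exact Complex.norm_deriv_le_of_forall_mem_sphere_norm_le hr0 (hgd c) (hMg c)⟩
    exact (hasDerivAt_lp_of_coord (fun ζ => Cfield hL hd V hV hε₀ hsm h44 (P + ζ • Q)) g hr0 (by norm_num) hG hgd
      hMg ⟨_, hDmem⟩ (fun c => rfl)).differentiableAt

/-! ## § 4  p. 267 for the genuine `Q̃`: existence and uniqueness of `D̃`, the linearization, the bounds -/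

/-- [cite: Balaban1987RG1, p.267][cite: Balaban1985Variational, p.286] **THE LINEARIZING CHANGE OF VARIABLES OF
P. 267 FOR [I]'S GENUINE `Q̃` ON `ℤᵈ`** — «We are looking for an analytic, 𝐠-valued function D̃(B), defined at bonds of
T⁽ᵏ⁺¹⁾, and such that the transformation B′ = B − hD̃(B) linearizes the function Q̃(B′). The function D̃(B) is
determined by the equation LQ̃B′ + C̃(B′) = LQ̃B − D̃(B) + C̃(B − hD̃(B)) = LQ̃B. It is easy to prove … that there
exists exactly one solution of this equation … D̃(B) has an expansion beginning with quadratic terms»: at a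
bondwise-`U1`, `ε₀`-regular `V` on `ℤᵈ` with `(dL)²ε₀ ≤ 1/200` and the Neumann budget `(Lᵈ/L)·24ω_A(ε₀) < 1`, in
the Banach space `ℓ^∞` of bounded bond fields, for every `ε` with `9C₂Hε < 1`, `3ε ≤ R` (`C₂ = 192000(dL)²`,
`R = 1/(4800dL)`, `H = (Lᵈ/L)/(1 − (Lᵈ/L)·24ω_A(ε₀))`): there is `D̃ : ℓ^∞ → ℓ^∞` with, for `‖B‖ < ε`,
`‖D̃(B)‖ ≤ 4C₂ε²`, the fixed-point equation `C̃_V(B − hD̃(B)) = D̃(B)`, the LINEARIZATION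
`LQ̃_V(B − hD̃(B)) + C̃_V(B − hD̃(B)) = LQ̃_V B`, `‖D̃(B)‖ ≤ 4C₂‖B‖²` (quadratic start), `‖D̃(B) − C̃_V(B)‖ ≤ 36C₂²H‖B‖³`
(`D̃⁽²⁾ = C̃⁽²⁾`); UNIQUENESS in the ball; `Φ(B) = B − hD̃(B)` injective on `‖B‖ < ε` and onto `‖B′‖ < ε/2` — the
tree's `B12Lineariz267.p267_linearizing_change_of_variables` with ALL ITS HYPOTHESES DISCHARGED for the genuine
average (§ 2–§ 3).  NOT CLAIMED: joint (Fréchet) analyticity of `D̃` on `ℓ^∞` (`B12LinearizAnalytic267` needs `C̃_V`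
Fréchet-analytic `ℓ^∞ → ℓ^∞`, not proved here), the torus, anything nonlinear beyond this change of variables. -/
theorem p267_genuine (ε : ℝ)
    (hq : 9 * (192000 * ((d : ℝ) * L) ^ 2) * (((L : ℝ) ^ d / L) / (1 - (L : ℝ) ^ d / L * (24 * omegaA d L ε₀))) * ε < 1)
    (hRC : 3 * ε ≤ 1 / (4800 * ((d : ℝ) * L))) :
    ∃ Dt : BField d 𝔸 → BField d 𝔸,
      (∀ B : BField d 𝔸, ‖B‖ < ε →
        Dt B ∈ closedBall (0 : BField d 𝔸) (4 * (192000 * ((d : ℝ) * L) ^ 2) * ε ^ 2) ∧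
        Cfield hL hd V hV hε₀ hsm h44 (B - hfield hL hd V hV hε₀ hsm h44 hbud (Dt B)) = Dt B ∧
        LQfield hL hd V hV hε₀ hsm h44 (B - hfield hL hd V hV hε₀ hsm h44 hbud (Dt B))
            + Cfield hL hd V hV hε₀ hsm h44 (B - hfield hL hd V hV hε₀ hsm h44 hbud (Dt B))
          = LQfield hL hd V hV hε₀ hsm h44 B ∧
        ‖Dt B‖ ≤ 4 * (192000 * ((d : ℝ) * L) ^ 2) * ‖B‖ ^ 2 ∧
        ‖Dt B - Cfield hL hd V hV hε₀ hsm h44 B‖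
          ≤ 36 * (192000 * ((d : ℝ) * L) ^ 2) ^ 2
            * (((L : ℝ) ^ d / L) / (1 - (L : ℝ) ^ d / L * (24 * omegaA d L ε₀))) * ‖B‖ ^ 3) ∧
      (∀ B : BField d 𝔸, ‖B‖ < ε → ∀ X ∈ closedBall (0 : BField d 𝔸) (4 * (192000 * ((d : ℝ) * L) ^ 2) * ε ^ 2),
        Cfield hL hd V hV hε₀ hsm h44 (B - hfield hL hd V hV hε₀ hsm h44 hbud X) = X → X = Dt B) ∧
      Set.InjOn (fun B => B - hfield hL hd V hV hε₀ hsm h44 hbud (Dt B)) (ball (0 : BField d 𝔸) ε) ∧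
      (∀ B' : BField d 𝔸, ‖B'‖ < ε / 2 →
        ‖B' + hfield hL hd V hV hε₀ hsm h44 hbud (Cfield hL hd V hV hε₀ hsm h44 B')‖ < ε ∧
        (B' + hfield hL hd V hV hε₀ hsm h44 hbud (Cfield hL hd V hV hε₀ hsm h44 B'))
          - hfield hL hd V hV hε₀ hsm h44 hbud (Dt (B' + hfield hL hd V hV hε₀ hsm h44 hbud
              (Cfield hL hd V hV hε₀ hsm h44 B'))) = B') :=
  B12Lineariz267.p267_linearizing_change_of_variables (LQfield_hfield hL hd V hV hε₀ hsm h44 hbud)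
    (quadAnalytic_Cfield hL hd V hV hε₀ hsm h44) (by positivity) (B12B0RestrictionAverage267.H_nonneg L d hbud)
    (norm_hfield_le hL hd V hV hε₀ hsm h44 hbud) hq hRC

/-- [cite: Balaban1987RG1, p.267] **«THE TRANSFORMATION B′ = B − hD̃(B) LINEARIZES THE FUNCTION Q̃(B′)»**, read
coordinatewise for the genuine `Q̃` of (2.4): with `D̃` as in `p267_genuine`, `Q̃_V(B − hD̃(B))(c) = (LQ̃_V B)(c)` for
every coarse bond `c` and every `‖B‖ < ε`. -/
theorem linearizes_genuine (ε : ℝ)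
    (hq : 9 * (192000 * ((d : ℝ) * L) ^ 2) * (((L : ℝ) ^ d / L) / (1 - (L : ℝ) ^ d / L * (24 * omegaA d L ε₀))) * ε < 1)
    (hRC : 3 * ε ≤ 1 / (4800 * ((d : ℝ) * L))) :
    ∃ Dt : BField d 𝔸 → BField d 𝔸, ∀ B : BField d 𝔸, ‖B‖ < ε →
      ‖Dt B‖ ≤ 4 * (192000 * ((d : ℝ) * L) ^ 2) * ‖B‖ ^ 2 ∧
      ∀ c : ZdEdge d,
        Qtilde L (fun U : ZdEdge d → 𝔸ˣ => Tavg L U) V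
            (((B - hfield hL hd V hV hε₀ hsm h44 hbud (Dt B) : BField d 𝔸) : ZdEdge d → 𝔸)) c
          = LQ L (fun U : ZdEdge d → 𝔸ˣ => Tavg L U) V (⇑B) c := by
  obtain ⟨Dt, hDt, -, -, -⟩ := p267_genuine hL hd V hV hε₀ hsm h44 hbud ε hq hRC
  have hdL : 0 < (d : ℝ) * L := by
    have : (1 : ℝ) ≤ d := by exact_mod_cast hd
    have : (0 : ℝ) < L := by exact_mod_cast hL
    positivity
  set C₂ : ℝ := 192000 * ((d : ℝ) * L) ^ 2 with hC₂
  set H : ℝ := ((L : ℝ) ^ d / L) / (1 - (L : ℝ) ^ d / L * (24 * omegaA d L ε₀))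
  have hH0 : 0 ≤ H := B12B0RestrictionAverage267.H_nonneg L d hbud
  refine ⟨Dt, fun B hB => ?_⟩
  obtain ⟨hball, -, hlin, hquad, -⟩ := hDt B hB
  refine ⟨hquad, fun c => ?_⟩
  have hε0 : 0 < ε := (norm_nonneg B).trans_lt hB
  -- `‖B − hD̃(B)‖ < 2ε`, so the small-ball unfolding of `C̃_V` applies
  have hDn : ‖Dt B‖ ≤ 4 * C₂ * ε ^ 2 := by rwa [mem_closedBall, dist_zero_right] at hball
  have hhD : ‖hfield hL hd V hV hε₀ hsm h44 hbud (Dt B)‖ ≤ ε := by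
    refine (norm_hfield_le hL hd V hV hε₀ hsm h44 hbud (Dt B)).trans ?_
    have hC₂0 : 0 ≤ C₂ := by rw [hC₂]; positivity
    have hx : 0 ≤ C₂ * H * ε := mul_nonneg (mul_nonneg hC₂0 hH0) hε0.le
    have h4 : 4 * C₂ * H * ε ≤ 1 := by nlinarith [hq, hx]
    calc H * ‖Dt B‖ ≤ H * (4 * C₂ * ε ^ 2) := mul_le_mul_of_nonneg_left hDn hH0
      _ = (4 * C₂ * H * ε) * ε := by ring
      _ ≤ 1 * ε := mul_le_mul_of_nonneg_right h4 hε0.le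
      _ = ε := one_mul ε
  have hB' : ‖B - hfield hL hd V hV hε₀ hsm h44 hbud (Dt B)‖ * ((d : ℝ) * L) ≤ 1 / 1200 := by
    have h1 : ‖B - hfield hL hd V hV hε₀ hsm h44 hbud (Dt B)‖ ≤ 2 * ε := by
      refine (norm_sub_le _ _).trans ?_; linarith
    have h2 : 2 * ε * ((d : ℝ) * L) ≤ 1 / 1200 := by
      have := mul_le_mul_of_nonneg_right hRC hdL.le
      rw [show 1 / (4800 * ((d : ℝ) * L)) * ((d : ℝ) * L) = 1 / 4800 by field_simp] at this
      nlinarith [this, hε0, hdL]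
    exact (mul_le_mul_of_nonneg_right h1 hdL.le).trans h2
  have := congrArg (fun Z : BField d 𝔸 => (Z : ZdEdge d → 𝔸) c) hlin
  simp only at this
  rw [LQfield_add_Cfield_apply hL hd V hV hε₀ hsm h44 _ hB' c, LQfield_apply] at this
  exact this

end Maps

/-! ## § 5  (v1.1, append-only)  Non-vacuity: the flat background `V ≡ 1` -/

section Flat

variable {d : ℕ}
variable {𝔸 : Type*} [NormedRing 𝔸] [NormedAlgebra ℂ 𝔸] [NormOneClass 𝔸] [CompleteSpace 𝔸] {L : ℕ}

/-- [cite: Balaban1987RG1, p.267] the hypotheses of `p267_genuine`/`linearizes_genuine` HOLD at the flat background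
`V ≡ 1` with `ε₀ = 0` (bondwise `U1`, all plaquette variables `= 1`, `(dL)²·0 ≤ 1/200`, Neumann budget
`(Lᵈ/L)·24ω_A(0) = 0 < 1`), for every `d` and `L` — `B12ContourAverage253.flat_average` repackaged. -/
theorem flat_hypotheses {𝔸 : Type*} [NormedRing 𝔸] [NormOneClass 𝔸] (L : ℕ) :
    (∀ b, (1 : ZdEdge d → 𝔸ˣ) b ∈ U1 𝔸) ∧ ((0 : ℝ) ≤ 0) ∧ (((d : ℝ) * L) ^ 2 * 0 ≤ 1 / 200) ∧
    (∀ (p : Fin d → ℤ) (i j : Fin d), i ≠ j →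
        ‖((plaquetteHolonomyZd (1 : ZdEdge d → 𝔸ˣ) p i j : 𝔸ˣ) : 𝔸) - 1‖ ≤ (0 : ℝ)) ∧
    ((L : ℝ) ^ d / L * (24 * omegaA d L 0) < 1) := by
  obtain ⟨h1, h2, h3, -, -, h6⟩ := B12ContourAverage253.flat_average (𝔸 := 𝔸) (d := d) L
  exact ⟨fun b => mem_U1.2 ⟨h1 b, h2 b⟩, le_rfl, by norm_num, h3, h6⟩

/-- [cite: Balaban1987RG1, p.267] **NON-VACUITY OF THE P. 267 CHANGE OF VARIABLES FOR THE GENUINE `Q̃`**: at the flat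
background `V ≡ 1` (`ε₀ = 0`, hypotheses by `flat_hypotheses`), for every `L ≥ 1`, `d ≥ 1` and every complete normed
algebra `𝔸`, there IS a radius `ε > 0` (any `ε ≤ R/3`, `ε < 1/(9C₂H)`) on whose ball `D̃` exists with quadratic start
and `B′ = B − hD̃(B)` linearizes `Q̃_1`: `Q̃_1(B − hD̃(B))(c) = (LQ̃_1 B)(c)` for all coarse bonds `c`. -/
theorem linearizes_genuine_flat (hL : 0 < L) (hd : 1 ≤ d) (hV : ∀ b, (1 : ZdEdge d → 𝔸ˣ) b ∈ U1 𝔸)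
    (hε₀ : (0 : ℝ) ≤ 0) (hsm : ((d : ℝ) * L) ^ 2 * 0 ≤ 1 / 200)
    (h44 : ∀ (p : Fin d → ℤ) (i j : Fin d), i ≠ j →
        ‖((plaquetteHolonomyZd (1 : ZdEdge d → 𝔸ˣ) p i j : 𝔸ˣ) : 𝔸) - 1‖ ≤ (0 : ℝ))
    (hbud : (L : ℝ) ^ d / L * (24 * omegaA d L 0) < 1) :
    ∃ ε : ℝ, 0 < ε ∧ ∃ Dt : BField d 𝔸 → BField d 𝔸, ∀ B : BField d 𝔸, ‖B‖ < ε →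
      ‖Dt B‖ ≤ 4 * (192000 * ((d : ℝ) * L) ^ 2) * ‖B‖ ^ 2 ∧
      ∀ c : ZdEdge d,
        Qtilde L (fun U : ZdEdge d → 𝔸ˣ => Tavg L U) 1
            (((B - hfield hL hd 1 hV hε₀ hsm h44 hbud (Dt B) : BField d 𝔸) : ZdEdge d → 𝔸)) c
          = LQ L (fun U : ZdEdge d → 𝔸ˣ => Tavg L U) 1 (⇑B) c := by
  have hdL : 0 < (d : ℝ) * L := by
    have : (1 : ℝ) ≤ d := by exact_mod_cast hd
    have : (0 : ℝ) < L := by exact_mod_cast hL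
    positivity
  set C₂ : ℝ := 192000 * ((d : ℝ) * L) ^ 2 with hC₂
  set H : ℝ := ((L : ℝ) ^ d / L) / (1 - (L : ℝ) ^ d / L * (24 * omegaA d L 0)) with hH
  have hC₂0 : 0 ≤ C₂ := by rw [hC₂]; positivity
  have hH0 : 0 ≤ H := B12B0RestrictionAverage267.H_nonneg L d hbud
  have hR0 : 0 < 1 / (4800 * ((d : ℝ) * L)) := by positivity
  set ε : ℝ := min (1 / (4800 * ((d : ℝ) * L)) / 3) (1 / (9 * C₂ * H + 1)) with hε
  have hK0 : 0 < 9 * C₂ * H + 1 := by positivity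
  have hε0 : 0 < ε := lt_min (by positivity) (by positivity)
  have hRC : 3 * ε ≤ 1 / (4800 * ((d : ℝ) * L)) := by
    have := min_le_left (1 / (4800 * ((d : ℝ) * L)) / 3) (1 / (9 * C₂ * H + 1)); linarith
  have hq : 9 * C₂ * H * ε < 1 := by
    have h1 : ε ≤ 1 / (9 * C₂ * H + 1) := min_le_right _ _
    have h2 : 9 * C₂ * H * ε ≤ 9 * C₂ * H * (1 / (9 * C₂ * H + 1)) :=
      mul_le_mul_of_nonneg_left h1 (by positivity)
    have h3 : 9 * C₂ * H * (1 / (9 * C₂ * H + 1)) < 1 := by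
      rw [mul_one_div, div_lt_one hK0]; linarith
    exact h2.trans_lt h3
  exact ⟨ε, hε0, linearizes_genuine hL hd 1 hV hε₀ hsm h44 hbud ε hq hRC⟩

end Flat

end Literature.MathematicalPhysics.QuantumFieldTheory.Balaban1983to89.B12LinearizationGenuineZd

end
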